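import Summits.RiemannHypothesis.RiemannHypothesis.Theses.SmoothSectorHardy
import Summits.RiemannHypothesis.RiemannHypothesis.Theses.ScrewLemmaKCoprofile
import Summits.RiemannHypothesis.RiemannHypothesis.Theorems.ScrewLemmaKCoprofileCoprofileParseval
import HarnessLib

/-!
# Route `SmoothSectorHardy`, item `ProfileParsevalFE` (K1b, stmt-RiemannHypothesis-22983) FROM
# route `ScrewLemmaKCoprofile`'s crux `CoprofileIsometry` (K1, stmt-RiemannHypothesis-21612)

The L17 → L14 bridge in the direction K1 ⇒ K1b: the co-profile ISOMETRY
`∫₀¹(h−h₀)²/y² + h₀² = (4π²)⁻¹∫₀¹Φ_g²` (item 21612, for every admissible `g` with the integrability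
proviso) and the co-profile PARSEVAL `∫₀¹Φ_g² = (2π)⁻¹∫_ℝ‖G(−½+it)‖²‖ζ(3/2+it)‖²dt` (item 22439,
PROVED in the tree: `…Theorems.ScrewLemmaKCoprofile.coprofileParseval`) give
`∫₀¹(h−h₀)²/y² + h₀² = (8π³)⁻¹∫_ℝ‖G(−½+it)‖²‖ζ(3/2+it)‖²dt` — verbatim the conclusion of
`ProfileParsevalFE` (rev 1), whose global hypothesis `ProfileMellinFormula` (item 22982, proved) is
then not even needed.  So once `CoprofileIsometry` is closed (its `_holds` link appended to the L17
route file), `ProfileParsevalFE` closes by ONE application of the theorem below.  Pure glue (real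
arithmetic).  RH-free; nothing here bears on the truth of RH.
-/

set_option linter.dupNamespace false

noncomputable section

namespace Summit.RiemannHypothesis.RiemannHypothesis.Theorems.SmoothSectorHardy

open MeasureTheory Set
open Summit.RiemannHypothesis.RiemannHypothesis.Theorems.ScrewLemmaKCoprofile (coprofileParseval)

/-- **K1 ⇒ K1b**: route `ScrewLemmaKCoprofile`'s `CoprofileIsometry` implies route
`SmoothSectorHardy`'s `ProfileParsevalFE` (via the tree's co-profile Parseval,
`(4π²)⁻¹·(2π)⁻¹ = (8π³)⁻¹`). [folklore] -/
theorem profileParsevalFE_of_coprofileIsometry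
    (hK1 : Summit.RiemannHypothesis.RiemannHypothesis.Theses.ScrewLemmaKCoprofile.CoprofileIsometry) :
    Summit.RiemannHypothesis.RiemannHypothesis.Theses.SmoothSectorHardy.ProfileParsevalFE := by
  unfold Summit.RiemannHypothesis.RiemannHypothesis.Theses.SmoothSectorHardy.ProfileParsevalFE
  intro _ g hg hint
  have h1 := hK1 g hg hint
  have h2 := coprofileParseval g hg
  rw [h1, h2]
  ring

end Summit.RiemannHypothesis.RiemannHypothesis.Theorems.SmoothSectorHardy

end
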